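import Mathlib
import HarnessLib

/-!
# An abelian normal subgroup of `GL₂(𝔽_ℓ)` (`ℓ ≥ 5` prime) is central

Stub `stub_abelianNormalCentral` (kernel K4 of the CM-type-partner slice) of line `SketchIdeator5`
of crux U `Summit.ABC.ABC.Theses.IsogenyGlueCongruence.EllipticGluingPrimeBound` (stmt-ABC-13919).

**Statement.** For a prime `ℓ ≥ 5`, every normal subgroup `N ⊴ GL₂(ℤ/ℓ)` which is abelian is
contained in the centre.

**Proof (elementary, no Dickson / no simplicity of `PSL₂`).** Let `x = (p q; r s) ∈ N`. Normality
puts the conjugates `u x u⁻¹`, `w x w⁻¹` by the two elementary unipotents `u = (1 1; 0 1)`,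
`w = (1 0; 1 1)` in `N`, and commutativity of `N` makes them commute with `x`. Reading off matrix
entries: the `(2,1)` entry of `x (u x u⁻¹) = (u x u⁻¹) x` gives `2 r² = 0`, the `(1,2)` entry of
`x (w x w⁻¹) = (w x w⁻¹) x` gives `2 q² = 0`, so `q = r = 0` (as `2 ≠ 0` in `ℤ/ℓ`), and then the
`(1,2)` entry of the first relation gives `(s - p)² = 0`, i.e. `x = p · 1` is scalar, hence central.
Only `ℓ ≠ 2` is used. Pure Mathlib; no cited facts.
-/

-- `Summit.<Summit>.<Problem>` is the mandated summit-side namespace (CONVENTIONS §2); for the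
-- single-conjunct summit `ABC` the two coincide, so the duplicate `ABC.ABC` is deliberate.
set_option linter.dupNamespace false

namespace Summit.ABC.ABC.Theorems.GluingSlices

open Matrix

/-- Matrix core: over a field with `2 ≠ 0`, an invertible `2 × 2` matrix `x` commuting with its
conjugates by the two elementary unipotent matrices is scalar: its off-diagonal entries vanish and
its diagonal entries agree. -/
theorem fin_two_scalar_of_commute_unipotent_conj {F : Type*} [Field F] (h2 : (2 : F) ≠ 0)
    (x : Matrix (Fin 2) (Fin 2) F)
    (hu : x * (!![1, 1; 0, 1] * x * !![1, -1; 0, 1]) = (!![1, 1; 0, 1] * x * !![1, -1; 0, 1]) * x)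
    (hw : x * (!![1, 0; 1, 1] * x * !![1, 0; -1, 1]) = (!![1, 0; 1, 1] * x * !![1, 0; -1, 1]) * x) :
    x 0 1 = 0 ∧ x 1 0 = 0 ∧ x 0 0 = x 1 1 := by
  -- the three scalar relations read off the matrix identities
  have e21 := congrFun (congrFun hu 1) 0
  have e12w := congrFun (congrFun hw 0) 1
  have e12 := congrFun (congrFun hu 0) 1
  simp only [mul_apply, Fin.sum_univ_two, of_apply, cons_val', cons_val_zero, cons_val_one,
    empty_val', cons_val_fin_one] at e21 e12w e12
  -- `2 r² = 0`, `2 q² = 0`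
  have hr : x 1 0 = 0 := by
    have h : (2 : F) * (x 1 0 * x 1 0) = 0 := by linear_combination e21
    rcases mul_eq_zero.mp h with h | h
    · exact absurd h h2
    · exact mul_self_eq_zero.mp h
  have hq : x 0 1 = 0 := by
    have h : (2 : F) * (x 0 1 * x 0 1) = 0 := by linear_combination e12w
    rcases mul_eq_zero.mp h with h | h
    · exact absurd h h2
    · exact mul_self_eq_zero.mp h
  -- `(s - p)² = 0`
  have hps : x 0 0 = x 1 1 := by
    have h : (x 1 1 - x 0 0) * (x 1 1 - x 0 0) = 0 := by
      rw [hr, hq] at e12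
      linear_combination -e12
    have := mul_self_eq_zero.mp h
    exact (sub_eq_zero.mp this).symm
  exact ⟨hq, hr, hps⟩

/-- **(K4) An abelian normal subgroup of `GL₂(ℤ/ℓ)`, `ℓ ≥ 5` prime, is central.**
Registered stub `stub_abelianNormalCentral` of line `SketchIdeator5` (signature verbatim). -/
theorem stub_abelianNormalCentral :
    ∀ (ℓ : ℕ) [Fact ℓ.Prime], 5 ≤ ℓ →
      ∀ N : Subgroup (Matrix.GeneralLinearGroup (Fin 2) (ZMod ℓ)), N.Normal →
        (∀ x ∈ N, ∀ y ∈ N, x * y = y * x) →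
          N ≤ Subgroup.center (Matrix.GeneralLinearGroup (Fin 2) (ZMod ℓ)) := by
  intro ℓ hℓ h5 N hN hab x hx
  -- `2 ≠ 0` in `ℤ/ℓ`
  have h2 : (2 : ZMod ℓ) ≠ 0 := by
    intro h
    have hdvd : ℓ ∣ 2 := (ZMod.natCast_eq_zero_iff 2 ℓ).mp (by exact_mod_cast h)
    have := Nat.le_of_dvd (by norm_num) hdvd
    omega
  -- the two elementary unipotents as units
  let u : GL (Fin 2) (ZMod ℓ) :=
    ⟨!![1, 1; 0, 1], !![1, -1; 0, 1],
      by simp [Matrix.one_fin_two],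
      by simp [Matrix.one_fin_two]⟩
  let w : GL (Fin 2) (ZMod ℓ) :=
    ⟨!![1, 0; 1, 1], !![1, 0; -1, 1],
      by simp [Matrix.one_fin_two],
      by simp [Matrix.one_fin_two]⟩
  -- `x` commutes with its conjugates by `u` and `w`
  have hcu := hab x hx (u * x * u⁻¹) (hN.conj_mem x hx u)
  have hcw := hab x hx (w * x * w⁻¹) (hN.conj_mem x hx w)
  have hcu' := congrArg (fun g : GL (Fin 2) (ZMod ℓ) ↦ (g : Matrix (Fin 2) (Fin 2) (ZMod ℓ))) hcu
  have hcw' := congrArg (fun g : GL (Fin 2) (ZMod ℓ) ↦ (g : Matrix (Fin 2) (Fin 2) (ZMod ℓ))) hcw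
  simp only [Units.val_mul] at hcu' hcw'
  have hui : ((u⁻¹ : GL (Fin 2) (ZMod ℓ)) : Matrix (Fin 2) (Fin 2) (ZMod ℓ)) = !![1, -1; 0, 1] := rfl
  have hwi : ((w⁻¹ : GL (Fin 2) (ZMod ℓ)) : Matrix (Fin 2) (Fin 2) (ZMod ℓ)) = !![1, 0; -1, 1] := rfl
  have huv : ((u : GL (Fin 2) (ZMod ℓ)) : Matrix (Fin 2) (Fin 2) (ZMod ℓ)) = !![1, 1; 0, 1] := rfl
  have hwv : ((w : GL (Fin 2) (ZMod ℓ)) : Matrix (Fin 2) (Fin 2) (ZMod ℓ)) = !![1, 0; 1, 1] := rfl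
  rw [hui, huv] at hcu'
  rw [hwi, hwv] at hcw'
  obtain ⟨hq, hr, hps⟩ :=
    fin_two_scalar_of_commute_unipotent_conj h2 (x : Matrix (Fin 2) (Fin 2) (ZMod ℓ)) hcu' hcw'
  -- a scalar matrix is central
  have hscalar : (x : Matrix (Fin 2) (Fin 2) (ZMod ℓ)) =
      (x : Matrix (Fin 2) (Fin 2) (ZMod ℓ)) 1 1 • (1 : Matrix (Fin 2) (Fin 2) (ZMod ℓ)) := by
    ext i j
    fin_cases i <;> fin_cases j <;> simp [hq, hr, hps]
  rw [Subgroup.mem_center_iff]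
  intro g
  apply Units.ext
  simp only [Units.val_mul]
  rw [hscalar, Matrix.mul_smul, Matrix.smul_mul, mul_one, one_mul]

end Summit.ABC.ABC.Theorems.GluingSlices
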